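import Summits.Ventures.CertifiedManyBodySolver.Observables.TorusPairLROCeilingTTPrime

/-!
# Koma–Tasaki's Theorem 7.3 on ALL large tori (uniform in the ground state), every `t'`

Cell `hubbard-cq` (venture `CertifiedManyBodySolver`; seat hubbard-cq-p4, KT dictionary (44), TORUS HALF). Sequel of
`TorusPairLROCeilingTTPrime.lean`, whose theorems are stated along SEQUENCES of ground-state vectors `ψ_{L_j}`
(`∀ ε > 0`, eventually in `j`). Here the same statements are made UNIFORM IN THE GROUND STATE:
`∀ ε > 0 ∃ L₀ ∀ L ≥ L₀ ∀` unit ground-state vector `ψ` of the torus of side `L`, by the purely logical passage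
`exists_forall_le_of_seq` (if it failed, a bad ground state at unboundedly many sides would assemble into a bad
sequence — choice + extraction; no new analysis).

* `exists_forall_le_of_seq` — sequences ⇒ all large tori (generic in a predicate `P` and a functional `F`).
* `exists_forall_groundStates_torusDiagonal_le` — GC tori `A_L(t',U,μ,h)`, `h ≥ 0`: eventually in `L`, EVERY unit
  ground state has `s_L(ψ) ≤ (∂⁺E(h)/2)² + ε`; `…_le_sq_dWaveOrderParameterTT'_add` (`h = 0`: `≤ (m⋆)² + ε`);
  `…_of_not_hasDWaveOrderTT'` (`m⋆ = 0 ⇒ s_L(ψ) ≤ ε` for all GS of all large tori);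
  `exists_forall_groundStates_sq_half_leftDeriv_sub_le_torusDiagonal` (`h > 0` floor `(∂⁻E(h)/2)² − ε ≤ s_L(ψ)`).
* `exists_forall_sectorGroundStates_torusDiagonal_le` — the summit's sector class (`hubbardTorusTT' L 1 t' U`,
  sectors `(rectN n L, S^z = 0)`, `U ≥ 0`, `0 < n < 2`): `m⋆(μ)² ≤ c` at every supporting `μ` ⇒ eventually every
  sector ground state has `s_L ≤ c + ε`.

`s_L(ψ) = torusDiagonal dWaveFormFactor L ψ = L⁻⁴ Re⟨ψ, Δ_d†Δ_d ψ⟩`. HONEST SCOPE: ceilings by the response (known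
direction, KT93 Thm 7.3), asymptotic, no rate; no number, no instrument; not a superconductivity verdict.
Everything PROVED; no definition; zero compute.

References: T. Koma, H. Tasaki, Commun. Math. Phys. 158 (1993) 191, Theorem 7.3 [cite: KomaTasaki1993, Theorem 7.3];
R. B. Griffiths, Phys. Rev. 152 (1966) 240, §II [cite: Griffiths1966, §II].
-/

noncomputable section

namespace Summit.Ventures.CertifiedManyBodySolver.Observables.TorusPairLROCeiling

open Matrix Finset Filter Topology Set Literature.MathematicalPhysics.QuantumLattice
open Literature.Probability.LatticeModels HubbardWave0 ThermodynamicLimit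
open scoped ComplexOrder

/-! ### From ground-state SEQUENCES to ALL ground states of ALL large tori (uniform forms) -/

section Uniform

/-- **SEQUENCES ⇒ ALL LARGE TORI**: if along EVERY strictly increasing sequence of (positive) sides and EVERY
family of torus vectors satisfying `P` the functional `F` is eventually `≤ b`, then for all large `L` every
vector satisfying `P L` has `F L ≤ b` (contraposition: bad vectors at unboundedly many sides assemble into a bad
family). [folklore] -/
theorem exists_forall_le_of_seq {P : ∀ (L : ℕ) [NeZero L], Fock (Orb (FermionTorus 2 L)) → Prop}
    {F : ∀ (L : ℕ) [NeZero L], Fock (Orb (FermionTorus 2 L)) → ℝ} {b : ℝ}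
    (hseq : ∀ Ls : ℕ → ℕ, StrictMono Ls → ∀ [∀ j, NeZero (Ls j)], ∀ ψ : ∀ L, Fock (Orb (FermionTorus 2 L)),
      (∀ j, P (Ls j) (ψ (Ls j))) → ∀ᶠ j in atTop, F (Ls j) (ψ (Ls j)) ≤ b) :
    ∃ L₀ : ℕ, ∀ (L : ℕ) [NeZero L], L₀ ≤ L → ∀ ψ : Fock (Orb (FermionTorus 2 L)), P L ψ → F L ψ ≤ b := by
  by_contra hnot
  have hfreq : ∃ᶠ L in atTop, ∃ (_ : NeZero L) (ψ : Fock (Orb (FermionTorus 2 L))), P L ψ ∧ b < F L ψ := by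
    refine frequently_atTop.2 fun L₀ => ?_
    by_contra hL₀
    refine hnot ⟨L₀, fun L _ hL ψ hP => ?_⟩
    by_contra hF
    exact hL₀ ⟨L, hL, ‹NeZero L›, ψ, hP, not_le.1 hF⟩
  obtain ⟨φ, hφ, hbad⟩ := extraction_of_frequently_atTop hfreq
  choose inst χ hP hF using hbad
  haveI : ∀ k, NeZero (φ k) := inst
  classical
  -- the bad vectors, assembled into one family of torus vectors (extended by `0` off the sequence)
  let Ψ : ∀ L : ℕ, Fock (Orb (FermionTorus 2 L)) := fun L =>
    if hL : ∃ k, φ k = L then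
      cast (congrArg (fun n => Fock (Orb (FermionTorus 2 n))) hL.choose_spec) (χ hL.choose)
    else 0
  have hfam : ∀ k, Ψ (φ k) = χ k := by
    intro k
    have hL : ∃ k', φ k' = φ k := ⟨k, rfl⟩
    have key : ∀ (m : ℕ) (e : φ m = φ k),
        cast (congrArg (fun n => Fock (Orb (FermionTorus 2 n))) e) (χ m) = χ k := by
      intro m e
      have hm : m = k := hφ.injective e
      subst hm
      exact cast_eq _ _
    simp only [Ψ, dif_pos hL]
    exact key hL.choose hL.choose_spec
  have hev := hseq φ hφ Ψ (fun k => by rw [hfam]; exact hP k)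
  obtain ⟨k, hk⟩ := hev.exists
  rw [hfam] at hk
  exact absurd hk (not_le.2 (hF k))

variable {t' U μ h : ℝ}

/-- **KOMA–TASAKI'S THEOREM 7.3 ON ALL LARGE TORI, every `t'`, every `h ≥ 0`** (uniform in the ground state):
`∀ ε > 0 ∃ L₀ ∀ L ≥ L₀`, EVERY unit ground-state vector `ψ` of `A_L(t',U,μ,h)` has
`L⁻⁴ Re⟨ψ, Δ_d†Δ_d ψ⟩ ≤ (∂⁺E(h)/2)² + ε`. [cite: KomaTasaki1993, Theorem 7.3] -/
theorem exists_forall_groundStates_torusDiagonal_le (t' U μ : ℝ) (hh : 0 ≤ h) {ε : ℝ} (hε : 0 < ε) :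
    ∃ L₀ : ℕ, ∀ (L : ℕ) [NeZero L], L₀ ≤ L → ∀ ψ : Fock (Orb (FermionTorus 2 L)), star ψ ⬝ᵥ ψ = 1 →
      dWaveSourceTorusTT' L t' U μ h *ᵥ ψ = (((dWaveSourceTorusTT' L t' U μ h).groundEnergy : ℝ) : ℂ) • ψ →
      torusDiagonal dWaveFormFactor L ψ ≤
        (derivWithin (dWaveSourceEnergyDensityTT' t' U μ) (Ioi h) h / 2) ^ 2 + ε := by
  obtain ⟨L₀, hL₀⟩ := exists_forall_le_of_seq
    (P := fun L _ ψ => star ψ ⬝ᵥ ψ = 1 ∧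
      dWaveSourceTorusTT' L t' U μ h *ᵥ ψ = (((dWaveSourceTorusTT' L t' U μ h).groundEnergy : ℝ) : ℂ) • ψ)
    (F := fun L _ ψ => torusDiagonal dWaveFormFactor L ψ)
    (b := (derivWithin (dWaveSourceEnergyDensityTT' t' U μ) (Ioi h) h / 2) ^ 2 + ε)
    (fun Ls hLs _ ψ hP =>
      eventually_torusDiagonal_le_of_groundStates hLs.tendsto_atTop hh (fun j => (hP j).1) (fun j => (hP j).2) hε)
  exact ⟨L₀, fun L _ hL ψ h1 h2 => hL₀ L hL ψ ⟨h1, h2⟩⟩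

/-- **At zero field, uniform**: `∀ ε > 0 ∃ L₀ ∀ L ≥ L₀`, every unit ground-state vector of the
grand-canonical `t–t'` torus `hubbardTorusTT' − μN` has `L⁻⁴ Re⟨ψ, Δ_d†Δ_d ψ⟩ ≤ (m⋆)² + ε`.
[cite: KomaTasaki1993, Theorem 7.3] -/
theorem exists_forall_groundStates_torusDiagonal_le_sq_dWaveOrderParameterTT'_add (t' U μ : ℝ) {ε : ℝ}
    (hε : 0 < ε) :
    ∃ L₀ : ℕ, ∀ (L : ℕ) [NeZero L], L₀ ≤ L → ∀ ψ : Fock (Orb (FermionTorus 2 L)), star ψ ⬝ᵥ ψ = 1 →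
      dWaveSourceTorusTT' L t' U μ 0 *ᵥ ψ = (((dWaveSourceTorusTT' L t' U μ 0).groundEnergy : ℝ) : ℂ) • ψ →
      torusDiagonal dWaveFormFactor L ψ ≤ dWaveOrderParameterTT' t' U μ ^ 2 + ε := by
  have hsq : (derivWithin (dWaveSourceEnergyDensityTT' t' U μ) (Ioi 0) 0 / 2) ^ 2 =
      dWaveOrderParameterTT' t' U μ ^ 2 := by
    rw [dWaveOrderParameterTT'_eq_neg_half_rightDeriv]; ring
  obtain ⟨L₀, hL₀⟩ := exists_forall_groundStates_torusDiagonal_le t' U μ (le_refl (0 : ℝ)) hε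
  refine ⟨L₀, fun L _ hL ψ h1 h2 => ?_⟩
  have := hL₀ L hL ψ h1 h2
  rwa [hsq] at this

/-- **No quasi-average `d`-wave order ⇒ uniformly small torus pair LRO in ALL grand-canonical ground states of
ALL large tori**: `¬HasDWaveOrderTT' t' U μ → ∀ ε > 0 ∃ L₀ ∀ L ≥ L₀ ∀ unit GS ψ, L⁻⁴ Re⟨ψ, Δ_d†Δ_d ψ⟩ ≤ ε`.
[cite: KomaTasaki1993, Theorem 7.3] -/
theorem exists_forall_groundStates_torusDiagonal_le_of_not_hasDWaveOrderTT' {t' U μ : ℝ}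
    (hno : ¬ HasDWaveOrderTT' t' U μ) {ε : ℝ} (hε : 0 < ε) :
    ∃ L₀ : ℕ, ∀ (L : ℕ) [NeZero L], L₀ ≤ L → ∀ ψ : Fock (Orb (FermionTorus 2 L)), star ψ ⬝ᵥ ψ = 1 →
      dWaveSourceTorusTT' L t' U μ 0 *ᵥ ψ = (((dWaveSourceTorusTT' L t' U μ 0).groundEnergy : ℝ) : ℂ) • ψ →
      torusDiagonal dWaveFormFactor L ψ ≤ ε := by
  have h0 : dWaveOrderParameterTT' t' U μ = 0 :=
    le_antisymm (not_lt.1 hno) (dWaveOrderParameterTT'_nonneg t' U μ)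
  obtain ⟨L₀, hL₀⟩ := exists_forall_groundStates_torusDiagonal_le_sq_dWaveOrderParameterTT'_add t' U μ hε
  refine ⟨L₀, fun L _ hL ψ h1 h2 => ?_⟩
  have := hL₀ L hL ψ h1 h2
  rwa [h0, zero_pow two_ne_zero, zero_add] at this

/-- **The torus FLOOR at `h > 0`, uniform**: `∀ ε > 0 ∃ L₀ ∀ L ≥ L₀`, every unit ground-state vector of
`A_L(t',U,μ,h)` has `(∂⁻E(h)/2)² − ε ≤ L⁻⁴ Re⟨ψ, Δ_d†Δ_d ψ⟩`. [cite: Griffiths1966, §II] -/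
theorem exists_forall_groundStates_sq_half_leftDeriv_sub_le_torusDiagonal (t' U μ : ℝ) (hh : 0 < h) {ε : ℝ}
    (hε : 0 < ε) :
    ∃ L₀ : ℕ, ∀ (L : ℕ) [NeZero L], L₀ ≤ L → ∀ ψ : Fock (Orb (FermionTorus 2 L)), star ψ ⬝ᵥ ψ = 1 →
      dWaveSourceTorusTT' L t' U μ h *ᵥ ψ = (((dWaveSourceTorusTT' L t' U μ h).groundEnergy : ℝ) : ℂ) • ψ →
      (derivWithin (dWaveSourceEnergyDensityTT' t' U μ) (Iio h) h / 2) ^ 2 - ε ≤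
        torusDiagonal dWaveFormFactor L ψ := by
  obtain ⟨L₀, hL₀⟩ := exists_forall_le_of_seq
    (P := fun L _ ψ => star ψ ⬝ᵥ ψ = 1 ∧
      dWaveSourceTorusTT' L t' U μ h *ᵥ ψ = (((dWaveSourceTorusTT' L t' U μ h).groundEnergy : ℝ) : ℂ) • ψ)
    (F := fun L _ ψ => -torusDiagonal dWaveFormFactor L ψ)
    (b := -((derivWithin (dWaveSourceEnergyDensityTT' t' U μ) (Iio h) h / 2) ^ 2 - ε))
    (fun Ls hLs _ ψ hP => by
      filter_upwards [eventually_sq_half_leftDeriv_sub_le_torusDiagonal hLs.tendsto_atTop hh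
        (fun j => (hP j).1) (fun j => (hP j).2) hε] with j hj
      exact neg_le_neg hj)
  refine ⟨L₀, fun L _ hL ψ h1 h2 => ?_⟩
  have := hL₀ L hL ψ ⟨h1, h2⟩
  linarith

variable {n : ℝ}

/-- **The summit's SECTOR class, uniform**: if `m⋆(t',U,μ)² ≤ c` at every chemical potential supporting a
density-`n` translation-invariant ground state (`U ≥ 0`, `0 < n < 2`), then `∀ ε > 0 ∃ L₀ ∀ L ≥ L₀`, EVERY unit
ground state `ψ` of `hubbardTorusTT' L 1 t' U` in the sector `(rectN n L, S^z = 0)` has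
`L⁻⁴ Re⟨ψ, Δ_d†Δ_d ψ⟩ ≤ c + ε`. [cite: KomaTasaki1993, Theorem 7.3] -/
theorem exists_forall_sectorGroundStates_torusDiagonal_le (t' : ℝ) (hU : 0 ≤ U) (hn0 : 0 < n) (hn2 : n < 2)
    {c : ℝ}
    (hc : ∀ (μ : ℝ) (ω : InfVolFermionState 2), ω.IsMeanEnergyMinimiser (hubbardTTPrimeMuInteraction 1 t' U μ) 1 →
      ω.density = n → dWaveOrderParameterTT' t' U μ ^ 2 ≤ c)
    {ε : ℝ} (hε : 0 < ε) :
    ∃ L₀ : ℕ, ∀ (L : ℕ) [NeZero L], L₀ ≤ L → ∀ ψ : Fock (Orb (FermionTorus 2 L)), star ψ ⬝ᵥ ψ = 1 →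
      IsGroundStateInSector (hubbardTorusTT' L 1 t' U) (rectN n L) 0 ψ →
      torusDiagonal dWaveFormFactor L ψ ≤ c + ε := by
  obtain ⟨L₀, hL₀⟩ := exists_forall_le_of_seq
    (P := fun L _ ψ => star ψ ⬝ᵥ ψ = 1 ∧ IsGroundStateInSector (hubbardTorusTT' L 1 t' U) (rectN n L) 0 ψ)
    (F := fun L _ ψ => torusDiagonal dWaveFormFactor L ψ) (b := c + ε)
    (fun Ls hLs _ ψ hP =>
      eventually_torusDiagonal_le_of_sectorGroundStates hU hn0 hn2 hLs.tendsto_atTop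
        (fun j => (hP j).2) (fun j => (hP j).1) hc hε)
  exact ⟨L₀, fun L _ hL ψ h1 h2 => hL₀ L hL ψ ⟨h1, h2⟩⟩

end Uniform

end Summit.Ventures.CertifiedManyBodySolver.Observables.TorusPairLROCeiling

end
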